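import Summits.ValiantsHypothesis.ValiantsHypothesis.Theorems.KPlusLogSqLawTropicalBComparabilityNestedLaw
import Summits.ValiantsHypothesis.ValiantsHypothesis.Theorems.KPlusLogSqLawTropicalBAdjacentRecordsBudget

/-!
# `TropicalB` (stmt-ValiantsHypothesis-19771) — three-register comparability chains: the ROW-SUM LAW
# `D ≤ (3N+1)·L₁ + 3·Σ_a occ(a)` (the first register contributes only additively)

Helper file for the crux `Theses.KPlusLogSqLaw.TropicalB` (`--supports stmt-ValiantsHypothesis-19771 --as helper`), cell
`pub-symmetroid`, seat val-sym-trop-p2 (g6).  HONEST FRAMING as in `…TropicalBComparabilityNested{,Law}` (p500459 / p500874): a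
structure theorem about a SUB-FAMILY of the terms of an arbitrary design, hypotheses verbatim those of g5's
`ComparabilityChain.card_dominant_le_three`; nothing about `TropicalB` in its window, `WeakLifting`, `MatrixDescartes`
(stmt-ValiantsHypothesis-18050) or VP ≠ VNP.

## Statement (`card_dominant_le_rowSum`)
Let `occ(a)` be the number of states `(b, p, u)` of middle row `a`'s own right system that occur in some dominant member (the set of
`ComparabilityChain.card_rowStates_le`, which bounds each `occ(a)` by `(3(1+U)+1)·L₂`).  THEN the number `D` of dominant members satisfies

  `D ≤ (3N + 1)·L₁ + 3·Σ_a occ(a)`.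

Since trivially `Σ_a occ(a) ≤ D` (every occurring (row, state) pair occurs in a member), this says: up to the factor 3 and the additive
first-register term `(3N+1)·L₁`, the three-register count EQUALS the count of its (middle, third)-projection — the first register
contributes only additively.  The NESTED LINEAR LAW `card_dominant_le_nested` (p500874) is the special case `occ(a) ≤ (3U+4)·L₂` for every
row; the located quadratic conjecture of the lineage (HOME/val-sym-trop-p2/g6/NESTED-LINEAR.md R37) is thereby EQUIVALENT, in the kernel,
to `Σ_a occ(a) = O(N·L₁ + L₁L₂ + U·L₂)`.

Also: the trivial converse `Σ_a occ(a) ≤ D` and the mirror COLUMN-SUM law `D ≤ (3U+1)·L₂ + 3·Σ_b cocc(b)`.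
PROOF: the budget form of trop-p5's abstract count (`card_le_of_adjacent_records_budget`, p504730) on the projected system «first
register against the ROWS with their occurring states» (row-record predicate = OR over the row's occurring states of interval-shaped
predicates ⇒ flip budget `2·occ(a)`; state set = occurring states); exchange steps via `u_lt/rw_lt_of_dominant` (p500459).
-/

set_option linter.dupNamespace false
set_option autoImplicit false

namespace Summit.ValiantsHypothesis.ValiantsHypothesis.Theorems.KPlusLogSqLaw.ComparabilityChain

open Summit.ValiantsHypothesis.ValiantsHypothesis.Theorems.MatrixDescartes.Negative
open Summit.ValiantsHypothesis.ValiantsHypothesis.Theorems.KPlusLogSqLaw.ComparabilityLinear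
  (card_le_of_adjacent_records_budget card_flips_exists_le card_flips_le_two)
open Finset

/-- an OR over a FINSET of interval-shaped predicates changes truth value at most `2·|T|` times before time `n`
(finset-indexed form of trop-p5's `card_flips_exists_le`). -/
theorem card_flips_exists_finset_le {ι : Type*} (n : ℕ) (T : Finset ι) (Q : ι → ℕ → Prop) [∀ i, DecidablePred (Q i)]
    [DecidablePred (fun k => ∃ i ∈ T, Q i k)]
    (hQ : ∀ i ∈ T, ∀ a b c : ℕ, a < b → b < c → c < n → Q i a → Q i c → Q i b) :
    ((Finset.range n).filter (fun k => k + 1 < n ∧ ¬ ((∃ i ∈ T, Q i k) ↔ (∃ i ∈ T, Q i (k + 1))))).card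
      ≤ 2 * T.card := by
  classical
  have hcov : (Finset.range n).filter (fun k => k + 1 < n ∧ ¬ ((∃ i ∈ T, Q i k) ↔ (∃ i ∈ T, Q i (k + 1)))) ⊆
      T.biUnion (fun i => (Finset.range n).filter (fun k => k + 1 < n ∧ ¬ (Q i k ↔ Q i (k + 1)))) := by
    intro k hk
    simp only [Finset.mem_filter, Finset.mem_range, Finset.mem_biUnion] at hk ⊢
    obtain ⟨hkn, hk1, hne⟩ := hk
    by_contra hall
    push Not at hall
    apply hne
    constructor
    · rintro ⟨i, hi, hq⟩
      exact ⟨i, hi, ((hall i hi hkn hk1)).1 hq⟩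
    · rintro ⟨i, hi, hq⟩
      exact ⟨i, hi, ((hall i hi hkn hk1)).2 hq⟩
  calc ((Finset.range n).filter (fun k => k + 1 < n ∧ ¬ ((∃ i ∈ T, Q i k) ↔ (∃ i ∈ T, Q i (k + 1))))).card
      ≤ (T.biUnion (fun i => (Finset.range n).filter (fun k => k + 1 < n ∧ ¬ (Q i k ↔ Q i (k + 1))))).card :=
        Finset.card_le_card hcov
    _ ≤ ∑ i ∈ T, ((Finset.range n).filter (fun k => k + 1 < n ∧ ¬ (Q i k ↔ Q i (k + 1)))).card :=
        Finset.card_biUnion_le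
    _ ≤ ∑ _i ∈ T, 2 := Finset.sum_le_sum fun i hi => card_flips_le_two n (Q i) (hQ i hi)
    _ = 2 * T.card := by simp [mul_comm]

section Law

variable {m K N L₁ L₂ U : ℕ}
  (d : Fin K → ℕ) (v ε : Fin m → Fin m → Fin K → ℤ)
  (τ : Fin N → Fin L₁ → Fin L₁ → Fin L₂ → Fin L₂ → Fin U → Equiv.Perm (Fin m) × (Fin m → Fin K))
  (s₁ : Fin N → Fin L₁ → ℤ) (s₂ : Fin L₁ → Fin L₂ → ℤ) (s₃ : Fin L₂ → Fin U → ℤ)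
  (A : Fin N → Fin L₁ → ℤ) (W : Fin L₁ → Fin L₂ → ℤ) (B : Fin L₂ → Fin U → ℤ)
  (hinj : ∀ j y a b p u j' y' a' b' p' u', y < a → b < p → y' < a' → b' < p' →
    τ j y a b p u = τ j' y' a' b' p' u' → j = j' ∧ y = y' ∧ a = a' ∧ b = b' ∧ p = p' ∧ u = u')
  (hpres : ∀ j y a b p u, y < a → b < p → termSign ε (τ j y a b p u) ≠ 0)
  (hw : ∀ j y a b p u (θ : ℤ), y < a → b < p →
    tropWeight d v θ (τ j y a b p u) = θ * (s₁ j y + s₂ a b + s₃ p u) - (A j y + W a b + B p u))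

open scoped Classical in
include hinj hpres hw in
/-- **THE ROW-SUM LAW.**  With `occ(a) = #{(b,p,u) : b < p, ∃ j y θ, y < a ∧ IsDominant θ (τ j y a b p u)}` (the occurring states of
middle row `a`, cf. `card_rowStates_le`), the number of dominant members of the three-register comparability family is at most
`(3N+1)·L₁ + 3·Σ_a occ(a)`. -/
theorem card_dominant_le_rowSum :
    ((Finset.univ : Finset ((Fin N × Fin L₁ × Fin L₁ × Fin L₂ × Fin L₂ × Fin U))).filter (fun i => (i.2.1 < i.2.2.1 ∧ i.2.2.2.1 < i.2.2.2.2.1) ∧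
        ∃ θ : ℤ, IsDominant d v ε θ (τ i.1 i.2.1 i.2.2.1 i.2.2.2.1 i.2.2.2.2.1 i.2.2.2.2.2))).card
      ≤ (3 * N + 1) * L₁ + 3 * ∑ a : Fin L₁,
        ((Finset.univ : Finset (Fin L₂ × Fin L₂ × Fin U)).filter (fun s => s.1 < s.2.1 ∧
          ∃ (j : Fin N) (y : Fin L₁) (θ : ℤ), y < a ∧ IsDominant d v ε θ (τ j y a s.1 s.2.1 s.2.2))).card := by
  classical
  set D := (Finset.univ : Finset ((Fin N × Fin L₁ × Fin L₁ × Fin L₂ × Fin L₂ × Fin U))).filter (fun i => (i.2.1 < i.2.2.1 ∧ i.2.2.2.1 < i.2.2.2.2.1) ∧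
        ∃ θ : ℤ, IsDominant d v ε θ (τ i.1 i.2.1 i.2.2.1 i.2.2.2.1 i.2.2.2.2.1 i.2.2.2.2.2)) with hDdef
  let RS : Fin L₁ → Finset (Fin L₂ × Fin L₂ × Fin U) := fun a =>
    (Finset.univ : Finset (Fin L₂ × Fin L₂ × Fin U)).filter (fun s => s.1 < s.2.1 ∧
        ∃ (j : Fin N) (y : Fin L₁) (θ : ℤ), y < a ∧ IsDominant d v ε θ (τ j y a s.1 s.2.1 s.2.2))
  show D.card ≤ (3 * N + 1) * L₁ + 3 * ∑ a : Fin L₁, (RS a).card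
  have hmemD : ∀ i ∈ D, (i.2.1 < i.2.2.1 ∧ i.2.2.2.1 < i.2.2.2.2.1) ∧
      ∃ θ : ℤ, IsDominant d v ε θ (τ i.1 i.2.1 i.2.2.1 i.2.2.2.1 i.2.2.2.2.1 i.2.2.2.2.2) :=
    fun i hi => (Finset.mem_filter.1 hi).2
  have hmemRS : ∀ a s, s ∈ RS a ↔ s.1 < s.2.1 ∧
      ∃ (j : Fin N) (y : Fin L₁) (θ : ℤ), y < a ∧ IsDominant d v ε θ (τ j y a s.1 s.2.1 s.2.2) := fun a s => by
    simp only [RS, Finset.mem_filter, Finset.mem_univ, true_and]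
  have hex : ∀ i ∈ D, ∃ θ : ℤ, IsDominant d v ε θ (τ i.1 i.2.1 i.2.2.1 i.2.2.2.1 i.2.2.2.2.1 i.2.2.2.2.2) :=
    fun i hi => (hmemD i hi).2
  choose! Θ hΘ using hex
  have hΘinj : Set.InjOn Θ ↑D := by
    intro i hi i' hi' he
    have hi₁ := Finset.mem_coe.1 hi
    have hi₂ := Finset.mem_coe.1 hi'
    have h1 := hΘ i hi₁
    have h2 := hΘ i' hi₂
    rw [he] at h1
    obtain ⟨e1, e2, e3, e4, e5, e6⟩ := eq_of_theta_eq d v ε τ s₁ s₂ s₃ A W B hinj hpres hw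
      (hmemD i hi₁).1.1 (hmemD i hi₁).1.2 (hmemD i' hi₂).1.1 (hmemD i' hi₂).1.2 h1 h2
    exact Prod.ext e1 (Prod.ext e2 (Prod.ext e3 (Prod.ext e4 (Prod.ext e5 e6))))
  rcases D.eq_empty_or_nonempty with hDe | ⟨i₀, hi₀⟩
  · rw [hDe, Finset.card_empty]; exact Nat.zero_le _
  set n := D.card with hn
  have hT : (D.image Θ).card = n := Finset.card_image_of_injOn hΘinj
  let e : Fin n ↪o ℤ := (D.image Θ).orderEmbOfFin hT
  have hmemT : ∀ k : Fin n, ∃ i ∈ D, Θ i = e k := fun k => by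
    have h := Finset.orderEmbOfFin_mem (D.image Θ) hT k
    simpa only [Finset.mem_image] using h
  choose member hmem hΘmem using hmemT
  let mem' : ℕ → Fin N × Fin L₁ × Fin L₁ × Fin L₂ × Fin L₂ × Fin U := fun k => if h : k < n then member ⟨k, h⟩ else i₀
  have hmem'D : ∀ k, k < n → mem' k ∈ D := by
    intro k hk; simp only [mem', dif_pos hk]; exact hmem _
  have hmem'Θ : ∀ k (hk : k < n), Θ (mem' k) = e ⟨k, hk⟩ := by
    intro k hk; simp only [mem', dif_pos hk]; exact hΘmem _
  let t : ℕ → ℤ := fun k => Θ (mem' k)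
  have ht : ∀ k k', k < k' → k' < n → t k < t k' := by
    intro k k' hkk' hk'
    show Θ (mem' k) < Θ (mem' k')
    rw [hmem'Θ k (hkk'.trans hk'), hmem'Θ k' hk']
    exact e.strictMono (Fin.mk_lt_mk.2 hkk')
  have hmem'inj : ∀ k k', k < n → k' < n → mem' k = mem' k' → k = k' := by
    intro k k' hk hk' heq
    have h1 : e ⟨k, hk⟩ = e ⟨k', hk'⟩ := by rw [← hmem'Θ k hk, ← hmem'Θ k' hk', heq]
    have h2 := e.injective h1
    simpa using h2
  let jj : ℕ → Fin N := fun k => (mem' k).1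
  let yy : ℕ → Fin L₁ := fun k => (mem' k).2.1
  let aa : ℕ → Fin L₁ := fun k => (mem' k).2.2.1
  let st : ℕ → Fin L₂ × Fin L₂ × Fin U := fun k => (mem' k).2.2.2
  let M := Fintype.card (Fin L₂ × Fin L₂ × Fin U)
  let code : (Fin L₂ × Fin L₂ × Fin U) ≃ Fin M := Fintype.equivFin _
  let uu : ℕ → Fin M := fun k => code (st k)
  let slope : Fin L₁ → (Fin L₂ × Fin L₂ × Fin U) → ℤ := fun a s => s₂ a s.1 + s₃ s.2.1 s.2.2
  let icpt : Fin L₁ → (Fin L₂ × Fin L₂ × Fin U) → ℤ := fun a s => W a s.1 + B s.2.1 s.2.2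
  let σ₂ : Fin L₁ → Fin M → ℤ := fun a i => slope a (code.symm i)
  have hya : ∀ k, k < n → yy k < aa k := fun k hk => (hmemD _ (hmem'D k hk)).1.1
  have hbp : ∀ k, k < n → (st k).1 < (st k).2.1 := fun k hk => (hmemD _ (hmem'D k hk)).1.2
  have hdom : ∀ k, k < n → IsDominant d v ε (t k) (τ (jj k) (yy k) (aa k) (st k).1 (st k).2.1 (st k).2.2) :=
    fun k hk => hΘ _ (hmem'D k hk)
  have hstRS : ∀ k, k < n → st k ∈ RS (aa k) := fun k hk =>
    (hmemRS _ _).2 ⟨hbp k hk, jj k, yy k, t k, hya k hk, hdom k hk⟩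
  let RA : Fin L₁ → Fin N → ℕ → Prop := fun z j₀ k =>
    ∀ (j' : Fin N) (y' : Fin L₁), y' < z → t k * s₁ j' y' - A j' y' < t k * s₁ j₀ z - A j₀ z
  let RB : Fin L₁ → (Fin L₂ × Fin L₂ × Fin U) → ℕ → Prop := fun z s k =>
    ∀ (a' : Fin L₁) (s' : Fin L₂ × Fin L₂ × Fin U), z < a' → s'.1 < s'.2.1 →
      t k * slope a' s' - icpt a' s' < t k * slope z s - icpt z s
  let Ar : ℕ → Finset (Fin L₁) := fun k => (Finset.univ : Finset (Fin L₁)).filter (fun z => ∃ j₀, RA z j₀ k)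
  let Br : ℕ → Finset (Fin L₁) := fun k => (Finset.univ : Finset (Fin L₁)).filter (fun z => ∃ s ∈ RS z, RB z s k)
  have hmemAr : ∀ k z, z ∈ Ar k ↔ ∃ j₀, RA z j₀ k := fun k z => by
    simp only [Ar, Finset.mem_filter, Finset.mem_univ, true_and]
  have hmemBr : ∀ k z, z ∈ Br k ↔ ∃ s ∈ RS z, RB z s k := fun k z => by
    simp only [Br, Finset.mem_filter, Finset.mem_univ, true_and]
  have hrw : ∀ k, k < n → ∀ (a' : Fin L₁) (s' : Fin L₂ × Fin L₂ × Fin U), yy k < a' → s'.1 < s'.2.1 →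
      ¬ (aa k = a' ∧ st k = s') → t k * slope a' s' - icpt a' s' < t k * slope (aa k) (st k) - icpt (aa k) (st k) := by
    intro k hk a' s' hya' hbp' hne
    have h := rw_lt_of_dominant d v ε τ s₁ s₂ s₃ A W B hinj hpres hw (hya k hk) (hbp k hk) hya' hbp' (hdom k hk)
      (a' := a') (b' := s'.1) (p' := s'.2.1) (u' := s'.2.2)
      (by rintro ⟨e1, e2, e3, e4⟩; exact hne ⟨e1, Prod.ext e2 (Prod.ext e3 e4)⟩)
    simp only [slope, icpt]
    linarith
  have hadj : ∀ k, k < n → yy k ∈ Ar k ∧ aa k ∈ Br k ∧ yy k < aa k ∧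
      ∀ z : Fin L₁, yy k < z → z < aa k → z ∉ Ar k ∧ z ∉ Br k := by
    intro k hk
    have hD := hdom k hk
    have hya₀ := hya k hk
    have hbp₀ := hbp k hk
    refine ⟨(hmemAr k _).2 ⟨jj k, fun j' y' hy' => ?_⟩, (hmemBr k _).2 ⟨st k, hstRS k hk, fun a' s' ha' hs' => ?_⟩, hya₀,
      fun z hyz hza => ⟨fun h => ?_, fun h => ?_⟩⟩
    · exact u_lt_of_dominant d v ε τ s₁ s₂ s₃ A W B hinj hpres hw hya₀ hbp₀ (hy'.trans hya₀) hD
        (by rintro ⟨-, e2⟩; exact absurd e2 (ne_of_gt hy'))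
    · exact hrw k hk a' s' (hya₀.trans ha') hs' (by rintro ⟨e1, -⟩; exact absurd e1 (ne_of_lt ha'))
    · obtain ⟨j₀, hz⟩ := (hmemAr k z).1 h
      have h1 := hz (jj k) (yy k) hyz
      have h2 := u_lt_of_dominant d v ε τ s₁ s₂ s₃ A W B hinj hpres hw hya₀ hbp₀ hza hD (j' := j₀) (y' := z)
        (by rintro ⟨-, e2⟩; exact absurd e2 (ne_of_lt hyz))
      linarith
    · obtain ⟨s, hsRS, hz⟩ := (hmemBr k z).1 h
      have hsfeas : s.1 < s.2.1 := ((hmemRS z s).1 hsRS).1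
      have h1 := hz (aa k) (st k) hza hbp₀
      have h2 := hrw k hk z s hyz hsfeas (by rintro ⟨e1, -⟩; exact absurd e1 (ne_of_gt hza))
      linarith
  have hinj' : ∀ k k', k < n → k' < n → jj k = jj k' → yy k = yy k' → aa k = aa k' → uu k = uu k' → k = k' := by
    intro k k' hk hk' e1 e2 e3 e4
    have e4' : st k = st k' := code.injective e4
    exact hmem'inj k k' hk hk' (Prod.ext e1 (Prod.ext e2 (Prod.ext e3 e4')))
  have hRA : ∀ z j₀, ∀ a₁ b₁ c₁ : ℕ, a₁ < b₁ → b₁ < c₁ → c₁ < n → RA z j₀ a₁ → RA z j₀ c₁ → RA z j₀ b₁ := by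
    intro z j₀ a₁ b₁ c₁ hab hbc hc ha hc' j' y' hy'
    have h1 := ha j' y' hy'
    have h2 := hc' j' y' hy'
    have t1 := ht a₁ b₁ hab (hbc.trans hc)
    have t2 := ht b₁ c₁ hbc hc
    rcases le_or_gt (s₁ j' y' - s₁ j₀ z) 0 with hs | hs
    · nlinarith
    · nlinarith
  have hRB : ∀ z s, ∀ a₁ b₁ c₁ : ℕ, a₁ < b₁ → b₁ < c₁ → c₁ < n → RB z s a₁ → RB z s c₁ → RB z s b₁ := by
    intro z s a₁ b₁ c₁ hab hbc hc ha hc' a' s' ha' hs'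
    have h1 := ha a' s' ha' hs'
    have h2 := hc' a' s' ha' hs'
    have t1 := ht a₁ b₁ hab (hbc.trans hc)
    have t2 := ht b₁ c₁ hbc hc
    rcases le_or_gt (slope a' s' - slope z s) 0 with hs | hs
    · nlinarith
    · nlinarith
  have hflipA : ∀ z : Fin L₁,
      ((Finset.range n).filter (fun k => k + 1 < n ∧ ¬ (z ∈ Ar k ↔ z ∈ Ar (k + 1)))).card ≤ 2 * N := by
    intro z
    refine le_trans (Finset.card_le_card ?_) (card_flips_exists_le n N (fun j₀ k => RA z j₀ k) (hRA z))
    intro k hk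
    simp only [Finset.mem_filter] at hk ⊢
    rw [hmemAr, hmemAr] at hk
    exact hk
  have hflipB : ∀ z : Fin L₁,
      ((Finset.range n).filter (fun k => k + 1 < n ∧ ¬ (z ∈ Br k ↔ z ∈ Br (k + 1)))).card ≤ 2 * (RS z).card := by
    intro z
    refine le_trans (Finset.card_le_card ?_)
      (card_flips_exists_finset_le n (RS z) (fun s k => RB z s k) (fun s _ => hRB z s))
    intro k hk
    simp only [Finset.mem_filter] at hk ⊢
    rw [hmemBr, hmemBr] at hk
    exact hk
  have hS : ∀ k, k < n → uu k ∈ (RS (aa k)).image code := fun k hk =>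
    Finset.mem_image.2 ⟨st k, hstRS k hk, rfl⟩
  have hmono₁ : ∀ k k', k < k' → k' < n → yy k = yy k' → jj k ≠ jj k' → s₁ (jj k) (yy k) < s₁ (jj k') (yy k) := by
    intro k k' hkk' hk' hyy hjj
    have hk : k < n := hkk'.trans hk'
    have h1 := u_lt_of_dominant d v ε τ s₁ s₂ s₃ A W B hinj hpres hw (hya k hk) (hbp k hk) (hya k hk) (hdom k hk)
      (j' := jj k') (y' := yy k) (by rintro ⟨e, -⟩; exact hjj e)
    have h2 := u_lt_of_dominant d v ε τ s₁ s₂ s₃ A W B hinj hpres hw (hya k' hk') (hbp k' hk') (hya k' hk') (hdom k' hk')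
      (j' := jj k) (y' := yy k') (by rintro ⟨e, -⟩; exact hjj e.symm)
    rw [← hyy] at h2
    have t1 := ht k k' hkk' hk'
    nlinarith
  have hmono₂ : ∀ k k', k < k' → k' < n → aa k = aa k' → uu k ≠ uu k' → σ₂ (aa k) (uu k) < σ₂ (aa k) (uu k') := by
    intro k k' hkk' hk' haa huu
    have hk : k < n := hkk'.trans hk'
    have hst : st k ≠ st k' := fun h => huu (by simp only [uu, h])
    have h1 := hrw k hk (aa k) (st k') (hya k hk) (hbp k' hk')
      (by rintro ⟨-, e⟩; exact hst e)
    have hya' : yy k' < aa k := by rw [haa]; exact hya k' hk'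
    have h2 := hrw k' hk' (aa k) (st k) hya' (hbp k hk)
      (by rintro ⟨-, e⟩; exact hst e.symm)
    rw [← haa] at h2
    have t1 := ht k k' hkk' hk'
    have e1 : σ₂ (aa k) (uu k) = slope (aa k) (st k) := by simp only [σ₂, uu, Equiv.symm_apply_apply]
    have e2 : σ₂ (aa k) (uu k') = slope (aa k) (st k') := by simp only [σ₂, uu, Equiv.symm_apply_apply]
    rw [e1, e2]
    nlinarith
  have h := card_le_of_adjacent_records_budget n Ar Br yy aa jj uu s₁ σ₂ (fun z => (RS z).card)
    (fun z => (RS z).image code) hadj hinj' hflipA hflipB hS hmono₁ hmono₂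
  have hcard : ∀ z : Fin L₁, ((RS z).image code).card = (RS z).card := fun z =>
    Finset.card_image_of_injective _ code.injective
  simp only [hcard] at h
  omega

open scoped Classical in
/-- the trivial converse direction: every occurring (row, state) pair occurs in a member, so `Σ_a occ(a) ≤ D`. -/
theorem sum_rowStates_le_card_dominant :
    ∑ a : Fin L₁, ((Finset.univ : Finset (Fin L₂ × Fin L₂ × Fin U)).filter (fun s => s.1 < s.2.1 ∧
          ∃ (j : Fin N) (y : Fin L₁) (θ : ℤ), y < a ∧ IsDominant d v ε θ (τ j y a s.1 s.2.1 s.2.2))).card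
      ≤ ((Finset.univ : Finset ((Fin N × Fin L₁ × Fin L₁ × Fin L₂ × Fin L₂ × Fin U))).filter (fun i => (i.2.1 < i.2.2.1 ∧ i.2.2.2.1 < i.2.2.2.2.1) ∧
        ∃ θ : ℤ, IsDominant d v ε θ (τ i.1 i.2.1 i.2.2.1 i.2.2.2.1 i.2.2.2.2.1 i.2.2.2.2.2))).card := by
  classical
  set D := (Finset.univ : Finset ((Fin N × Fin L₁ × Fin L₁ × Fin L₂ × Fin L₂ × Fin U))).filter (fun i => (i.2.1 < i.2.2.1 ∧ i.2.2.2.1 < i.2.2.2.2.1) ∧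
        ∃ θ : ℤ, IsDominant d v ε θ (τ i.1 i.2.1 i.2.2.1 i.2.2.2.1 i.2.2.2.2.1 i.2.2.2.2.2)) with hDdef
  have hfib : D.card = ∑ a : Fin L₁, (D.filter (fun i => i.2.2.1 = a)).card :=
    Finset.card_eq_sum_card_fiberwise (fun i _ => Finset.mem_coe.2 (Finset.mem_univ (i.2.2.1)))
  rw [hfib]
  refine Finset.sum_le_sum fun a _ => ?_
  have hsub : (Finset.univ : Finset (Fin L₂ × Fin L₂ × Fin U)).filter (fun s => s.1 < s.2.1 ∧
        ∃ (j : Fin N) (y : Fin L₁) (θ : ℤ), y < a ∧ IsDominant d v ε θ (τ j y a s.1 s.2.1 s.2.2)) ⊆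
      (D.filter (fun i => i.2.2.1 = a)).image
        (fun i : (Fin N × Fin L₁ × Fin L₁ × Fin L₂ × Fin L₂ × Fin U) => i.2.2.2) := by
    intro s hs
    obtain ⟨hs1, j, y, θ, hya, hdom⟩ := by simpa only [Finset.mem_filter, Finset.mem_univ, true_and] using hs
    refine Finset.mem_image.2 ⟨(j, y, a, s), ?_, rfl⟩
    rw [Finset.mem_filter, hDdef, Finset.mem_filter]
    exact ⟨⟨Finset.mem_univ _, ⟨hya, hs1⟩, θ, hdom⟩, rfl⟩
  exact le_trans (Finset.card_le_card hsub) Finset.card_image_le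

open scoped Classical in
include hinj hpres hw in
/-- **THE COLUMN-SUM LAW** (mirror): `cocc(b) = #{(a, y, j) : y < a, ∃ p u θ, b < p ∧ IsDominant θ (τ j y a b p u)}` (occurring
(row, first-state) configurations of middle COLUMN `b`); `D ≤ (3U+1)·L₂ + 3·Σ_b cocc(b)` — the third register contributes only additively.
Proof: `card_dominant_le_rowSum` for the re-indexed family `τ̃ u (rev p) (rev b) (rev a) (rev y) j := τ j y a b p u`. -/
theorem card_dominant_le_colSum :
    ((Finset.univ : Finset ((Fin N × Fin L₁ × Fin L₁ × Fin L₂ × Fin L₂ × Fin U))).filter (fun i => (i.2.1 < i.2.2.1 ∧ i.2.2.2.1 < i.2.2.2.2.1) ∧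
        ∃ θ : ℤ, IsDominant d v ε θ (τ i.1 i.2.1 i.2.2.1 i.2.2.2.1 i.2.2.2.2.1 i.2.2.2.2.2))).card
      ≤ (3 * U + 1) * L₂ + 3 * ∑ b : Fin L₂,
        ((Finset.univ : Finset (Fin L₁ × Fin L₁ × Fin N)).filter (fun c => c.2.1 < c.1 ∧
          ∃ (p : Fin L₂) (u : Fin U) (θ : ℤ), b < p ∧ IsDominant d v ε θ (τ c.2.2 c.2.1 c.1 b p u))).card := by
  classical
  set D := (Finset.univ : Finset ((Fin N × Fin L₁ × Fin L₁ × Fin L₂ × Fin L₂ × Fin U))).filter (fun i => (i.2.1 < i.2.2.1 ∧ i.2.2.2.1 < i.2.2.2.2.1) ∧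
        ∃ θ : ℤ, IsDominant d v ε θ (τ i.1 i.2.1 i.2.2.1 i.2.2.2.1 i.2.2.2.2.1 i.2.2.2.2.2)) with hDdef
  have hmemD : ∀ i ∈ D, (i.2.1 < i.2.2.1 ∧ i.2.2.2.1 < i.2.2.2.2.1) ∧
      ∃ θ : ℤ, IsDominant d v ε θ (τ i.1 i.2.1 i.2.2.1 i.2.2.2.1 i.2.2.2.2.1 i.2.2.2.2.2) :=
    fun i hi => (Finset.mem_filter.1 hi).2
  let τm : Fin U → Fin L₂ → Fin L₂ → Fin L₁ → Fin L₁ → Fin N → Equiv.Perm (Fin m) × (Fin m → Fin K) :=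
    fun u q c z x j => τ j x.rev z.rev c.rev q.rev u
  let t₁ : Fin U → Fin L₂ → ℤ := fun u q => s₃ q.rev u
  let t₂ : Fin L₂ → Fin L₁ → ℤ := fun c z => s₂ z.rev c.rev
  let t₃ : Fin L₁ → Fin N → ℤ := fun x j => s₁ j x.rev
  let A₁ : Fin U → Fin L₂ → ℤ := fun u q => B q.rev u
  let W₂ : Fin L₂ → Fin L₁ → ℤ := fun c z => W z.rev c.rev
  let B₃ : Fin L₁ → Fin N → ℤ := fun x j => A j x.rev
  have hinjm : ∀ u q c z x j u' q' c' z' x' j', q < c → z < x → q' < c' → z' < x' →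
      τm u q c z x j = τm u' q' c' z' x' j' → u = u' ∧ q = q' ∧ c = c' ∧ z = z' ∧ x = x' ∧ j = j' := by
    intro u q c z x j u' q' c' z' x' j' hqc hzx hqc' hzx' h
    obtain ⟨e1, e2, e3, e4, e5, e6⟩ := hinj j x.rev z.rev c.rev q.rev u j' x'.rev z'.rev c'.rev q'.rev u'
      (Fin.rev_lt_rev.2 hzx) (Fin.rev_lt_rev.2 hqc) (Fin.rev_lt_rev.2 hzx') (Fin.rev_lt_rev.2 hqc') h
    exact ⟨e6, Fin.rev_injective e5, Fin.rev_injective e4, Fin.rev_injective e3, Fin.rev_injective e2, e1⟩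
  have hpresm : ∀ u q c z x j, q < c → z < x → termSign ε (τm u q c z x j) ≠ 0 :=
    fun u q c z x j hqc hzx => hpres j x.rev z.rev c.rev q.rev u (Fin.rev_lt_rev.2 hzx) (Fin.rev_lt_rev.2 hqc)
  have hwm : ∀ u q c z x j (θ : ℤ), q < c → z < x →
      tropWeight d v θ (τm u q c z x j) = θ * (t₁ u q + t₂ c z + t₃ x j) - (A₁ u q + W₂ c z + B₃ x j) := by
    intro u q c z x j θ hqc hzx
    show tropWeight d v θ (τ j x.rev z.rev c.rev q.rev u) =
      θ * (s₃ q.rev u + s₂ z.rev c.rev + s₁ j x.rev) - (B q.rev u + W z.rev c.rev + A j x.rev)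
    rw [hw j x.rev z.rev c.rev q.rev u θ (Fin.rev_lt_rev.2 hzx) (Fin.rev_lt_rev.2 hqc)]
    ring
  have h := card_dominant_le_rowSum d v ε τm t₁ t₂ t₃ A₁ W₂ B₃ hinjm hpresm hwm
  set Dm := (Finset.univ : Finset ((Fin U × Fin L₂ × Fin L₂ × Fin L₁ × Fin L₁ × Fin N))).filter (fun i => (i.2.1 < i.2.2.1 ∧ i.2.2.2.1 < i.2.2.2.2.1) ∧
        ∃ θ : ℤ, IsDominant d v ε θ (τm i.1 i.2.1 i.2.2.1 i.2.2.2.1 i.2.2.2.2.1 i.2.2.2.2.2)) with hDmdef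
  let ψ : (Fin N × Fin L₁ × Fin L₁ × Fin L₂ × Fin L₂ × Fin U) → (Fin U × Fin L₂ × Fin L₂ × Fin L₁ × Fin L₁ × Fin N) :=
    fun i => (i.2.2.2.2.2, i.2.2.2.2.1.rev, i.2.2.2.1.rev, i.2.2.1.rev, i.2.1.rev, i.1)
  have hψmem : ∀ i ∈ D, ψ i ∈ Dm := by
    intro i hi
    obtain ⟨⟨hya, hbp⟩, θ, hdom⟩ := hmemD i hi
    rw [hDmdef, Finset.mem_filter]
    refine ⟨Finset.mem_univ _, ⟨Fin.rev_lt_rev.2 hbp, Fin.rev_lt_rev.2 hya⟩, θ, ?_⟩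
    show IsDominant d v ε θ (τ i.1 i.2.1.rev.rev i.2.2.1.rev.rev i.2.2.2.1.rev.rev i.2.2.2.2.1.rev.rev i.2.2.2.2.2)
    simp only [Fin.rev_rev]
    exact hdom
  have hψinj : Set.InjOn ψ ↑D := by
    intro i _ i' _ hψ
    simp only [ψ, Prod.mk.injEq, Fin.rev_inj] at hψ
    obtain ⟨e6, e5, e4, e3, e2, e1⟩ := hψ
    exact Prod.ext e1 (Prod.ext e2 (Prod.ext e3 (Prod.ext e4 (Prod.ext e5 e6))))
  have hD : D.card ≤ Dm.card := Finset.card_le_card_of_injOn ψ hψmem hψinj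
  let RSm : Fin L₂ → Finset (Fin L₁ × Fin L₁ × Fin N) := fun c =>
    (Finset.univ : Finset (Fin L₁ × Fin L₁ × Fin N)).filter (fun s => s.1 < s.2.1 ∧
        ∃ (u : Fin U) (q : Fin L₂) (θ : ℤ), q < c ∧ IsDominant d v ε θ (τm u q c s.1 s.2.1 s.2.2))
  let CS : Fin L₂ → Finset (Fin L₁ × Fin L₁ × Fin N) := fun b =>
    (Finset.univ : Finset (Fin L₁ × Fin L₁ × Fin N)).filter (fun c => c.2.1 < c.1 ∧
          ∃ (p : Fin L₂) (u : Fin U) (θ : ℤ), b < p ∧ IsDominant d v ε θ (τ c.2.2 c.2.1 c.1 b p u))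
  show D.card ≤ (3 * U + 1) * L₂ + 3 * ∑ b : Fin L₂, (CS b).card
  have hRS : ∀ b : Fin L₂, (RSm b.rev).card = (CS b).card := by
    intro b
    refine Finset.card_bij (fun s _ => ((s.1.rev, s.2.1.rev, s.2.2) : Fin L₁ × Fin L₁ × Fin N)) ?_ ?_ ?_
    · intro s hs
      obtain ⟨hzx, u, q, θ, hqc, hdom⟩ := by simpa only [RSm, Finset.mem_filter, Finset.mem_univ, true_and] using hs
      simp only [CS, Finset.mem_filter, Finset.mem_univ, true_and]
      refine ⟨Fin.rev_lt_rev.2 hzx, q.rev, u, θ, ?_, ?_⟩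
      · have := Fin.rev_lt_rev.2 hqc
        simpa only [Fin.rev_rev] using this
      · have e : τm u q b.rev s.1 s.2.1 s.2.2 = τ s.2.2 s.2.1.rev s.1.rev b q.rev u := by
          show τ s.2.2 s.2.1.rev s.1.rev b.rev.rev q.rev u = _
          rw [Fin.rev_rev]
        rw [← e]; exact hdom
    · intro s _ s' _ he
      simp only [Prod.mk.injEq, Fin.rev_inj] at he
      exact Prod.ext he.1 (Prod.ext he.2.1 he.2.2)
    · intro c hc
      obtain ⟨hya, p, u, θ, hbp, hdom⟩ := by simpa only [CS, Finset.mem_filter, Finset.mem_univ, true_and] using hc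
      refine ⟨(c.1.rev, c.2.1.rev, c.2.2), ?_, by simp only [Fin.rev_rev]⟩
      simp only [RSm, Finset.mem_filter, Finset.mem_univ, true_and]
      refine ⟨Fin.rev_lt_rev.2 hya, u, p.rev, θ, Fin.rev_lt_rev.2 hbp, ?_⟩
      show IsDominant d v ε θ (τ c.2.2 c.2.1.rev.rev c.1.rev.rev b.rev.rev p.rev.rev u)
      simp only [Fin.rev_rev]
      exact hdom
  have hsum : ∑ c : Fin L₂, (RSm c).card = ∑ b : Fin L₂, (CS b).card := by
    rw [← Equiv.sum_comp Fin.revPerm (fun c => (RSm c).card)]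
    exact Finset.sum_congr rfl fun b _ => hRS b
  have h' : Dm.card ≤ (3 * U + 1) * L₂ + 3 * ∑ c : Fin L₂, (RSm c).card := h
  rw [hsum] at h'
  exact hD.trans h'

end Law

end Summit.ValiantsHypothesis.ValiantsHypothesis.Theorems.KPlusLogSqLaw.ComparabilityChain
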